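import Summits.CriticalPhenomena.PercolationContinuityZ3.Theorems.PercNearOneGluingNoHeavyQuantThreePortVTilesA
import Summits.CriticalPhenomena.PercolationContinuityZ3.Theorems.PercNearOneGluingNoHeavyQuantThreePortVTilesB
import Summits.CriticalPhenomena.PercolationContinuityZ3.Theorems.PercNearOneGluingNoHeavyQuantThreePortVTilesC
import Summits.CriticalPhenomena.PercolationContinuityZ3.Theorems.PercNearOneGluingNoHeavyQuantThreePortVTilesD
import Summits.CriticalPhenomena.PercolationContinuityZ3.Theorems.PercNearOneGluingNoHeavyQuantThreePortVTilesE
import Summits.CriticalPhenomena.PercolationContinuityZ3.Theorems.PercNearOneGluingNoHeavyQuantThreePortVTilesF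
import Summits.CriticalPhenomena.PercolationContinuityZ3.Theorems.PercNearOneGluingNoHeavyQuantThreePortVTilesG
import Summits.CriticalPhenomena.PercolationContinuityZ3.Theorems.PercNearOneGluingNoHeavyQuantThreePortVTilesH
import Summits.CriticalPhenomena.PercolationContinuityZ3.Theorems.PercNearOneGluingNoHeavyQuantThreePortVTilesI
import Summits.CriticalPhenomena.PercolationContinuityZ3.Theorems.PercNearOneGluingNoHeavyQuantThreePortVTilesJ
import Summits.CriticalPhenomena.PercolationContinuityZ3.Theorems.PercNearOneGluingNoHeavyQuantThreePortVTilesK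
import HarnessLib

/-!
# `Z(3,2)` at a three-port observer off the dominance collar — assembly of the region tiling `V_a ≥ 1/40`

builds on p205010 (kernel theorem, internal audit signed; external expert review pending)

Support file (`--supports stmt-CriticalPhenomena-4575`), seat `prim-quant-p1` (gen 5); memo `run/shared/lean/prim/quant/P1-SURPLUS.md` §16.
No definitions, no named facts, no sorries; standard axioms.

SETTING (`ThreePort`, as in `…QuantThreePortThreeTenths`): three-port observer `o` (pairs at `o` other than `o–a, o–b, o–c` have weight
`0`), hairs `α, β, γ`, ARBITRARY finite weighted graph off `o`; `le_one_reached_le_of_cellSolver₂` (p222750) reduces `Z(3,2)` at `o` to the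
real RESIDUAL SYSTEM in the hairs and the five off-`o` cells.  For the hair `h_v` write `V_v := h_u + h_w − h_u h_w − h_v` = P(one of the
OTHER two hairs is open) − P(hair `v` is open); `V_v ≥ 0` for all `v` iff no hair outweighs the union of the other two, and in the sorted
frame `γ ≤ β ≤ α` one has `V_a ≤ V_b, V_c` (`Vb_ge_Va`, `Vc_ge_Va`).
* `ThreePort.hairMargin_residual_false_sorted` — the residual system is contradictory on the REGION `0 ≤ γ ≤ β ≤ α ≤ ½`, `V_a ≥ 1/40`
  (all hair sizes): dispatch into the 26 tiles `vtile_*_false` of `…QuantThreePortVTilesA…K` (599 certified leaf boxes; chains with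
  V-floors `dtBoxV_b/c_false`, `gzBoxV_a_false`; vacuous boxes `vacVBox/vacSBox/vacBoxV_*_false`).
* `ThreePort.hairMargin_residual_false` — unsorted: hairs in `[0, ½]³` with `V_v ≥ 1/40` at the largest hair (six relabellings).
* `ThreePort.le_one_reached_le_of_hairMargin_le_half` / **`ThreePort.le_one_reached_le_of_hairMargin`** — **`Z(3,2)` at EVERY three-port
  observer whose hairs satisfy `h_v + 1/40 ≤ h_u + h_w − h_u h_w` for each `v`** (equivalently for the largest hair), for every finite weighted
  graph off `o`; hairs `≥ ½` by the heavy-hair theorem `pocketExchange_of_half_le_hair`.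
HONEST REMAINDER.  Together with `le_one_reached_le_of_hairs_ge_threeTenths` (p226512) the unconditional three-port region is
`{min hair ≥ 3/10} ∪ {V ≥ 1/40 at the largest hair} ∪ {some hair ≥ ½}`; what is left is the collar `{V_a < 1/40, min hair < 3/10}` around the
LENS where the abstract residual system is feasible (kit j101613, memo §16.3: 108/16 215 grid triples, all with `α ∈ [.43,.49]`, `β, γ ∈ [.20,.28]`,
`V_a ≤ 0.019`; explicit dyadic witnesses) — there no cell solver from the known rows exists and the missing input is a linear apex-pair row
(ineq-gen-8: `Z(3,2)³ᵖᵒʳᵗ ⟸ APL₁(κ)`, `κ > κ* = (5√3−6)/13`, p220977).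
[cite: GladkovZimin2024, Thm. 4.6]; [cite: Gladkov2024, Lemma 1.2 (2)]; [cite: KozmaNitzan2024, Lemma 2 (p. 6)] (context).
-/

noncomputable section

namespace Summit.CriticalPhenomena.PercolationContinuityZ3.Theorems

open MeasureTheory Set Literature.Probability.LatticeModels Literature.Probability.Percolation
open scoped Classical BigOperators

variable {n : ℕ}

namespace ThreePort

/-! ### Pure real algebra: the residual system on the region `V_a ≥ 1/40` -/

set_option maxHeartbeats 1000000 in
/-- **Sorted frame.**  On `0 ≤ γ ≤ β ≤ α ≤ ½` with `β + γ − βγ − α ≥ 1/40` the residual system (cells, caps, the GZ row at apex `a`, the two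
weak Lemma-1.2 rows with factor `(Ubc + U0)`, `Σ > 2`) is contradictory: kd-tree dispatch into the 26 certified tiles. [this work] -/
theorem hairMargin_residual_false_sorted (α β γ U0 Uab Uac Ubc U3 : ℝ)
    (a1 : 0 ≤ α) (a2 : α ≤ 1 / 2) (b1 : 0 ≤ β) (c1 : 0 ≤ γ) (hba : β ≤ α) (hcb : γ ≤ β)
    (hV : 1 / 40 ≤ β + γ - β * γ - α)
    (h0 : 0 ≤ U0) (hab : 0 ≤ Uab) (hac : 0 ≤ Uac) (hbc : 0 ≤ Ubc) (h3 : 0 ≤ U3)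
    (hsum : Uab + Uac + Ubc + U3 + U0 = 1)
    (ga : U0 * ((1 - α) * β * γ - α * (1 - β) * (1 - γ)) + Ubc * (β + γ - β * γ - α) < 0)
    (gb : U0 * ((1 - β) * α * γ - β * (1 - α) * (1 - γ)) + Uac * (α + γ - α * γ - β) < 0)
    (gc : U0 * ((1 - γ) * α * β - γ * (1 - α) * (1 - β)) + Uab * (α + β - α * β - γ) < 0)
    (hGZa : (U0 + Ubc) * (Uab + Uac + U3) ≤ Uab + Uac + Ubc)
    (rB1 : U0 ^ 2 ≤ (Ubc + U0) * (Uab + (Uac + U0) ^ 2)) (rC1 : U0 ^ 2 ≤ (Ubc + U0) * (Uac + (Uab + U0) ^ 2))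
    (hSig : 2 < (α + β + γ) + (α + β - 2 * α * β) * Uab + (α + γ - 2 * α * γ) * Uac + (β + γ - 2 * β * γ) * Ubc +
      ((1 - α) * (β + γ - β * γ) + (1 - β) * (α + γ - α * γ) + (1 - γ) * (α + β - α * β)) * U3) : False := by
  have b2 : β ≤ 1 / 2 := hba.trans a2
  have c2 : γ ≤ 1 / 2 := hcb.trans b2
  rcases le_or_gt α (1 / 4) with s0 | s0
  · exact vtile_L_false α β γ U0 Uab Uac Ubc U3 a1 s0 b1 b2 c1 c2 hba hcb hV h0 hab hac hbc h3 hsum ga gb gc hGZa rB1 rC1 hSig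
  · rcases le_or_gt β (1 / 4) with s1 | s1
    · exact vtile_RL_false α β γ U0 Uab Uac Ubc U3 s0.le a2 b1 s1 c1 c2 hba hcb hV h0 hab hac hbc h3 hsum ga gb gc hGZa rB1 rC1 hSig
    · rcases le_or_gt γ (1 / 4) with s2 | s2
      · rcases le_or_gt α (3 / 8) with s3 | s3
        · exact vtile_RRLL_false α β γ U0 Uab Uac Ubc U3 s0.le s3 s1.le b2 c1 s2 hba hcb hV h0 hab hac hbc h3 hsum ga gb gc hGZa rB1 rC1 hSig
        · exact vtile_RRLR_false α β γ U0 Uab Uac Ubc U3 s3.le a2 s1.le b2 c1 s2 hba hcb hV h0 hab hac hbc h3 hsum ga gb gc hGZa rB1 rC1 hSig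
      · rcases le_or_gt α (3 / 8) with s3 | s3
        · rcases le_or_gt β (3 / 8) with s4 | s4
          · rcases le_or_gt γ (3 / 8) with s5 | s5
            · rcases le_or_gt α (5 / 16) with s6 | s6
              · exact vtile_RRRLLLL_false α β γ U0 Uab Uac Ubc U3 s0.le s6 s1.le s4 s2.le s5 hba hcb hV h0 hab hac hbc h3 hsum ga gb gc hGZa rB1 rC1 hSig
              · rcases le_or_gt β (5 / 16) with s7 | s7
                · exact vtile_RRRLLLRL_false α β γ U0 Uab Uac Ubc U3 s6.le s3 s1.le s7 s2.le s5 hba hcb hV h0 hab hac hbc h3 hsum ga gb gc hGZa rB1 rC1 hSig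
                · exact vtile_RRRLLLRR_false α β γ U0 Uab Uac Ubc U3 s6.le s3 s7.le s4 s2.le s5 hba hcb hV h0 hab hac hbc h3 hsum ga gb gc hGZa rB1 rC1 hSig
            · exact vtile_RRRLLR_false α β γ U0 Uab Uac Ubc U3 s0.le s3 s1.le s4 s5.le c2 hba hcb hV h0 hab hac hbc h3 hsum ga gb gc hGZa rB1 rC1 hSig
          · exact vtile_RRRLR_false α β γ U0 Uab Uac Ubc U3 s0.le s3 s4.le b2 s2.le c2 hba hcb hV h0 hab hac hbc h3 hsum ga gb gc hGZa rB1 rC1 hSig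
        · rcases le_or_gt β (3 / 8) with s4 | s4
          · rcases le_or_gt γ (3 / 8) with s5 | s5
            · rcases le_or_gt α (7 / 16) with s6 | s6
              · rcases le_or_gt β (5 / 16) with s7 | s7
                · rcases le_or_gt γ (5 / 16) with s8 | s8
                  · rcases le_or_gt α (13 / 32) with s9 | s9
                    · exact vtile_RRRRLLLLLL_false α β γ U0 Uab Uac Ubc U3 s3.le s9 s1.le s7 s2.le s8 hba hcb hV h0 hab hac hbc h3 hsum ga gb gc hGZa rB1 rC1 hSig
                    · rcases le_or_gt β (9 / 32) with s10 | s10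
                      · rcases le_or_gt γ (9 / 32) with s11 | s11
                        · rcases le_or_gt α (27 / 64) with s12 | s12
                          · exact vtile_RRRRLLLLLRLLL_false α β γ U0 Uab Uac Ubc U3 s9.le s12 s1.le s10 s2.le s11 hba hcb hV h0 hab hac hbc h3 hsum ga gb gc hGZa rB1 rC1 hSig
                          · exact vtile_RRRRLLLLLRLLR_false α β γ U0 Uab Uac Ubc U3 s12.le s6 s1.le s10 s2.le s11 hba hcb hV h0 hab hac hbc h3 hsum ga gb gc hGZa rB1 rC1 hSig
                        · exact vtile_RRRRLLLLLRLR_false α β γ U0 Uab Uac Ubc U3 s9.le s6 s1.le s10 s11.le s8 hba hcb hV h0 hab hac hbc h3 hsum ga gb gc hGZa rB1 rC1 hSig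
                      · exact vtile_RRRRLLLLLRR_false α β γ U0 Uab Uac Ubc U3 s9.le s6 s10.le s7 s2.le s8 hba hcb hV h0 hab hac hbc h3 hsum ga gb gc hGZa rB1 rC1 hSig
                  · exact vtile_RRRRLLLLR_false α β γ U0 Uab Uac Ubc U3 s3.le s6 s1.le s7 s8.le s5 hba hcb hV h0 hab hac hbc h3 hsum ga gb gc hGZa rB1 rC1 hSig
                · exact vtile_RRRRLLLR_false α β γ U0 Uab Uac Ubc U3 s3.le s6 s7.le s4 s2.le s5 hba hcb hV h0 hab hac hbc h3 hsum ga gb gc hGZa rB1 rC1 hSig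
              · rcases le_or_gt β (5 / 16) with s7 | s7
                · rcases le_or_gt γ (5 / 16) with s8 | s8
                  · exact vtile_RRRRLLRLL_false α β γ U0 Uab Uac Ubc U3 s6.le a2 s1.le s7 s2.le s8 hba hcb hV h0 hab hac hbc h3 hsum ga gb gc hGZa rB1 rC1 hSig
                  · exact vtile_RRRRLLRLR_false α β γ U0 Uab Uac Ubc U3 s6.le a2 s1.le s7 s8.le s5 hba hcb hV h0 hab hac hbc h3 hsum ga gb gc hGZa rB1 rC1 hSig
                · exact vtile_RRRRLLRR_false α β γ U0 Uab Uac Ubc U3 s6.le a2 s7.le s4 s2.le s5 hba hcb hV h0 hab hac hbc h3 hsum ga gb gc hGZa rB1 rC1 hSig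
            · exact vtile_RRRRLR_false α β γ U0 Uab Uac Ubc U3 s3.le a2 s1.le s4 s5.le c2 hba hcb hV h0 hab hac hbc h3 hsum ga gb gc hGZa rB1 rC1 hSig
          · rcases le_or_gt γ (3 / 8) with s5 | s5
            · rcases le_or_gt α (7 / 16) with s6 | s6
              · rcases le_or_gt β (7 / 16) with s7 | s7
                · exact vtile_RRRRRLLL_false α β γ U0 Uab Uac Ubc U3 s3.le s6 s4.le s7 s2.le s5 hba hcb hV h0 hab hac hbc h3 hsum ga gb gc hGZa rB1 rC1 hSig
                · exact vtile_RRRRRLLR_false α β γ U0 Uab Uac Ubc U3 s3.le s6 s7.le b2 s2.le s5 hba hcb hV h0 hab hac hbc h3 hsum ga gb gc hGZa rB1 rC1 hSig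
              · exact vtile_RRRRRLR_false α β γ U0 Uab Uac Ubc U3 s6.le a2 s4.le b2 s2.le s5 hba hcb hV h0 hab hac hbc h3 hsum ga gb gc hGZa rB1 rC1 hSig
            · rcases le_or_gt α (7 / 16) with s6 | s6
              · rcases le_or_gt β (7 / 16) with s7 | s7
                · exact vtile_RRRRRRLL_false α β γ U0 Uab Uac Ubc U3 s3.le s6 s4.le s7 s5.le c2 hba hcb hV h0 hab hac hbc h3 hsum ga gb gc hGZa rB1 rC1 hSig
                · exact vtile_RRRRRRLR_false α β γ U0 Uab Uac Ubc U3 s3.le s6 s7.le b2 s5.le c2 hba hcb hV h0 hab hac hbc h3 hsum ga gb gc hGZa rB1 rC1 hSig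
              · exact vtile_RRRRRRR_false α β γ U0 Uab Uac Ubc U3 s6.le a2 s4.le b2 s5.le c2 hba hcb hV h0 hab hac hbc h3 hsum ga gb gc hGZa rB1 rC1 hSig

/-- **Pure real algebra, unsorted.**  Hairs in `[0, ½]³` with `h_v + 1/40 ≤ h_u + h_w − h_u h_w` for each `v`, nonnegative cells summing
to `1`, the three failed exchanges, the three Gladkov–Zimin rows, the six division-free Lemma-1.2 rows (`a`-dictionary of
`le_one_reached_le_of_cellSolver₂`) and `Σ_v μ(o↔v) > 2` are contradictory: relabel so that the hairs are sorted and apply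
`hairMargin_residual_false_sorted` with the rows and the margin hypothesis of that frame. [this work] -/
theorem hairMargin_residual_false (α β γ U0 Uab Uac Ubc U3 : ℝ)
    (hα0 : 0 ≤ α) (hα1 : α ≤ 1 / 2) (hβ0 : 0 ≤ β) (hβ1 : β ≤ 1 / 2) (hγ0 : 0 ≤ γ) (hγ1 : γ ≤ 1 / 2)
    (hVa : 1 / 40 ≤ β + γ - β * γ - α) (hVb : 1 / 40 ≤ α + γ - α * γ - β) (hVc : 1 / 40 ≤ α + β - α * β - γ)
    (h0 : 0 ≤ U0) (hab : 0 ≤ Uab) (hac : 0 ≤ Uac) (hbc : 0 ≤ Ubc) (h3 : 0 ≤ U3)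
    (hsum : Uab + Uac + Ubc + U3 + U0 = 1)
    (ga : U0 * ((1 - α) * β * γ - α * (1 - β) * (1 - γ)) + Ubc * (β + γ - β * γ - α) < 0)
    (gb : U0 * ((1 - β) * α * γ - β * (1 - α) * (1 - γ)) + Uac * (α + γ - α * γ - β) < 0)
    (gc : U0 * ((1 - γ) * α * β - γ * (1 - α) * (1 - β)) + Uab * (α + β - α * β - γ) < 0)
    (hGZa : (U0 + Ubc) * (Uab + Uac + U3) ≤ Uab + Uac + Ubc)
    (hGZb : (U0 + Uac) * (Uab + Ubc + U3) ≤ Uab + Uac + Ubc)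
    (hGZc : (U0 + Uab) * (Uac + Ubc + U3) ≤ Uab + Uac + Ubc)
    (rA1 : U0 ^ 2 ≤ (Uac + U0) * (Uab + (Ubc + U0) ^ 2)) (rA2 : U0 ^ 2 ≤ (Uab + U0) * (Uac + (Ubc + U0) ^ 2))
    (rB1 : U0 ^ 2 ≤ (Ubc + U0) * (Uab + (Uac + U0) ^ 2)) (rB2 : U0 ^ 2 ≤ (Uab + U0) * (Ubc + (Uac + U0) ^ 2))
    (rC1 : U0 ^ 2 ≤ (Ubc + U0) * (Uac + (Uab + U0) ^ 2)) (rC2 : U0 ^ 2 ≤ (Uac + U0) * (Ubc + (Uab + U0) ^ 2))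
    (hSig : 2 < (α + β + γ) + (α + β - 2 * α * β) * Uab + (α + γ - 2 * α * γ) * Uac + (β + γ - 2 * β * γ) * Ubc +
      ((1 - α) * (β + γ - β * γ) + (1 - β) * (α + γ - α * γ) + (1 - γ) * (α + β - α * β)) * U3) : False := by
  rcases le_total β α with hβα | hαβ
  · rcases le_total γ β with hγβ | hβγ
    · -- `γ ≤ β ≤ α`: identity
      exact hairMargin_residual_false_sorted α β γ U0 Uab Uac Ubc U3 hα0 hα1 hβ0 hγ0 hβα hγβ hVa h0 hab hac hbc h3 hsum
        ga gb gc hGZa rB1 rC1 hSig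
    · rcases le_total γ α with hγα | hαγ
      · -- `β ≤ γ ≤ α`: swap the roles of `b` and `c`
        exact hairMargin_residual_false_sorted α γ β U0 Uac Uab Ubc U3 hα0 hα1 hγ0 hβ0 hγα hβγ (by linarith only [hVa])
          h0 hac hab hbc h3 (by linarith only [hsum]) (by linarith only [ga]) (by linarith only [gc]) (by linarith only [gb])
          (by linarith only [hGZa]) rC1 rB1 (by linarith only [hSig])
      · -- `β ≤ α ≤ γ`: new roles `(a', b', c') = (c, a, b)`
        exact hairMargin_residual_false_sorted γ α β U0 Uac Ubc Uab U3 hγ0 hγ1 hα0 hβ0 hαγ hβα (by linarith only [hVc])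
          h0 hac hbc hab h3 (by linarith only [hsum]) (by linarith only [gc]) (by linarith only [ga]) (by linarith only [gb])
          (by linarith only [hGZc]) rA2 rB2 (by linarith only [hSig])
  · rcases le_total γ α with hγα | hαγ
    · -- `γ ≤ α ≤ β`: swap the roles of `a` and `b`
      exact hairMargin_residual_false_sorted β α γ U0 Uab Ubc Uac U3 hβ0 hβ1 hα0 hγ0 hαβ hγα (by linarith only [hVb])
        h0 hab hbc hac h3 (by linarith only [hsum]) (by linarith only [gb]) (by linarith only [ga]) (by linarith only [gc])
        (by linarith only [hGZb]) rA1 rC2 (by linarith only [hSig])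
    · rcases le_total γ β with hγβ | hβγ
      · -- `α ≤ γ ≤ β`: new roles `(a', b', c') = (b, c, a)`
        exact hairMargin_residual_false_sorted β γ α U0 Ubc Uab Uac U3 hβ0 hβ1 hγ0 hα0 hγβ hαγ (by linarith only [hVb])
          h0 hbc hab hac h3 (by linarith only [hsum]) (by linarith only [gb]) (by linarith only [gc]) (by linarith only [ga])
          (by linarith only [hGZb]) rC2 rA1 (by linarith only [hSig])
      · -- `α ≤ β ≤ γ`: new roles `(a', b', c') = (c, b, a)`
        exact hairMargin_residual_false_sorted γ β α U0 Ubc Uac Uab U3 hγ0 hγ1 hβ0 hα0 hβγ hαβ (by linarith only [hVc])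
          h0 hbc hac hab h3 (by linarith only [hsum]) (by linarith only [gc]) (by linarith only [gb]) (by linarith only [ga])
          (by linarith only [hGZc]) rB2 rA2 (by linarith only [hSig])

/-! ### The theorems at a three-port observer -/

/-- **`Z(3,2)` at a three-port observer off the dominance collar, hairs `≤ ½`.**  If `o` is adjacent (with positive weight) only to
`a, b, c`, the hairs are `≤ ½` and satisfy `h_v + 1/40 ≤ h_u + h_w − h_u h_w` for each `v`, `Σ_v μ(o↔v) > 2` and `t ≥ μ(o↮v)` for
`v = a, b, c`, then `μ{o reaches at most one of a, b, c} ≤ t`.  Instance of `le_one_reached_le_of_cellSolver₂` with the solver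
`hairMargin_residual_false`. [this work] -/
theorem le_one_reached_le_of_hairMargin_le_half (w : Sym2 (Fin n) → unitInterval) (R : Finset (Fin n)) (o a b c : Fin n)
    (t : ℝ) (hR : R = {a, b, c}) (hao : a ≠ o) (hbo : b ≠ o) (hco : c ≠ o) (hab : a ≠ b) (hac : a ≠ c) (hbc : b ≠ c)
    (hobs : ∀ u, u ≠ o → u ≠ a → u ≠ b → u ≠ c → w s(o, u) = 0)
    (hαhi : (w s(o, a) : ℝ) ≤ 1 / 2) (hβhi : (w s(o, b) : ℝ) ≤ 1 / 2) (hγhi : (w s(o, c) : ℝ) ≤ 1 / 2)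
    (hVa : (w s(o, a) : ℝ) + 1 / 40 ≤ w s(o, b) + w s(o, c) - w s(o, b) * w s(o, c))
    (hVb : (w s(o, b) : ℝ) + 1 / 40 ≤ w s(o, a) + w s(o, c) - w s(o, a) * w s(o, c))
    (hVc : (w s(o, c) : ℝ) + 1 / 40 ≤ w s(o, a) + w s(o, b) - w s(o, a) * w s(o, b))
    (hsum : 2 < (prodBernoulli w).real (openConn o a) + (prodBernoulli w).real (openConn o b) +
      (prodBernoulli w).real (openConn o c))
    (hta : (prodBernoulli w).real (openConn o a)ᶜ ≤ t) (htb : (prodBernoulli w).real (openConn o b)ᶜ ≤ t)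
    (htc : (prodBernoulli w).real (openConn o c)ᶜ ≤ t) :
    (prodBernoulli w).real {ω : BondConfig (Fin n) | (R.filter fun v => ω ∈ openConn o v).card ≤ 1} ≤ t :=
  le_one_reached_le_of_cellSolver₂ w R o a b c t hR hao hbo hco hab hac hbc hobs
    (fun U0 Uab Uac Ubc U3 h0 hab' hac' hbc' h3 hs ga gb gc hGZa hGZb hGZc rA1 rA2 rB1 rB2 rC1 rC2 hSig =>
      hairMargin_residual_false _ _ _ U0 Uab Uac Ubc U3 (w s(o, a)).2.1 hαhi (w s(o, b)).2.1 hβhi (w s(o, c)).2.1 hγhi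
        (by linarith only [hVa]) (by linarith only [hVb]) (by linarith only [hVc]) h0 hab' hac' hbc' h3 hs ga gb gc hGZa hGZb
        hGZc rA1 rA2 rB1 rB2 rC1 rC2 hSig)
    hsum hta htb htc

/-- **`Z(3,2)` at every three-port observer off the dominance collar** (no upper bound on the hairs): if each hair satisfies
`h_v + 1/40 ≤ h_u + h_w − h_u h_w` then, under `Σ_v μ(o↔v) > 2` and `t ≥ μ(o↮v)`, `μ{o reaches at most one of a, b, c} ≤ t`; a hair
`≥ ½` is the heavy-hair theorem `pocketExchange_of_half_le_hair`, otherwise `le_one_reached_le_of_hairMargin_le_half`.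
Complements `le_one_reached_le_of_hairs_ge_threeTenths`. [this work] -/
theorem le_one_reached_le_of_hairMargin (w : Sym2 (Fin n) → unitInterval) (R : Finset (Fin n)) (o a b c : Fin n)
    (t : ℝ) (hR : R = {a, b, c}) (hao : a ≠ o) (hbo : b ≠ o) (hco : c ≠ o) (hab : a ≠ b) (hac : a ≠ c) (hbc : b ≠ c)
    (hobs : ∀ u, u ≠ o → u ≠ a → u ≠ b → u ≠ c → w s(o, u) = 0)
    (hVa : (w s(o, a) : ℝ) + 1 / 40 ≤ w s(o, b) + w s(o, c) - w s(o, b) * w s(o, c))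
    (hVb : (w s(o, b) : ℝ) + 1 / 40 ≤ w s(o, a) + w s(o, c) - w s(o, a) * w s(o, c))
    (hVc : (w s(o, c) : ℝ) + 1 / 40 ≤ w s(o, a) + w s(o, b) - w s(o, a) * w s(o, b))
    (hsum : 2 < (prodBernoulli w).real (openConn o a) + (prodBernoulli w).real (openConn o b) +
      (prodBernoulli w).real (openConn o c))
    (hta : (prodBernoulli w).real (openConn o a)ᶜ ≤ t) (htb : (prodBernoulli w).real (openConn o b)ᶜ ≤ t)
    (htc : (prodBernoulli w).real (openConn o c)ᶜ ≤ t) :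
    (prodBernoulli w).real {ω : BondConfig (Fin n) | (R.filter fun v => ω ∈ openConn o v).card ≤ 1} ≤ t := by
  by_cases hhi : (w s(o, a) : ℝ) ≤ 1 / 2 ∧ (w s(o, b) : ℝ) ≤ 1 / 2 ∧ (w s(o, c) : ℝ) ≤ 1 / 2
  · exact le_one_reached_le_of_hairMargin_le_half w R o a b c t hR hao hbo hco hab hac hbc hobs hhi.1 hhi.2.1 hhi.2.2 hVa hVb
      hVc hsum hta htb htc
  have hhalf : (1 / 2 : ℝ) ≤ w s(o, a) ∨ (1 / 2 : ℝ) ≤ w s(o, b) ∨ (1 / 2 : ℝ) ≤ w s(o, c) := by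
    by_contra h
    push Not at h
    exact hhi ⟨h.1.le, h.2.1.le, h.2.2.le⟩
  have ha : a ∈ R := (by simp [hR]); have hb : b ∈ R := (by simp [hR]); have hc : c ∈ R := by simp [hR]
  have hobs' : ∀ u, u ≠ o → u ≠ b → u ≠ a → u ≠ c → w s(o, u) = 0 := fun u h1 h2 h3 h4 => hobs u h1 h3 h2 h4
  have hobs'' : ∀ u, u ≠ o → u ≠ c → u ≠ a → u ≠ b → w s(o, u) = 0 := fun u h1 h2 h3 h4 => hobs u h1 h3 h4 h2
  set μ := prodBernoulli w with hμ
  rcases le_total (μ.real (openConn o a)) (μ.real (openConn o b)) with hqab | hqba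
  · rcases le_total (μ.real (openConn o a)) (μ.real (openConn o c)) with hqac | hqca
    · exact (OneCutFive.measureReal_le_one_le_compl_of_exchange w R o a b c ha hb hc hab hac hbc
        (pocketExchange_of_half_le_hair w o a b c hao hbo hco hab hac hbc hobs hhalf hqab hqac)).trans hta
    · have hhalf' : (1 / 2 : ℝ) ≤ w s(o, c) ∨ (1 / 2 : ℝ) ≤ w s(o, a) ∨ (1 / 2 : ℝ) ≤ w s(o, b) := by tauto
      exact (OneCutFive.measureReal_le_one_le_compl_of_exchange w R o c a b hc ha hb hac.symm hbc.symm hab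
        (pocketExchange_of_half_le_hair w o c a b hco hao hbo hac.symm hbc.symm hab hobs'' hhalf' hqca
          (hqca.trans hqab))).trans htc
  · rcases le_total (μ.real (openConn o b)) (μ.real (openConn o c)) with hqbc | hqcb
    · have hhalf' : (1 / 2 : ℝ) ≤ w s(o, b) ∨ (1 / 2 : ℝ) ≤ w s(o, a) ∨ (1 / 2 : ℝ) ≤ w s(o, c) := by tauto
      exact (OneCutFive.measureReal_le_one_le_compl_of_exchange w R o b a c hb ha hc hab.symm hbc hac
        (pocketExchange_of_half_le_hair w o b a c hbo hao hco hab.symm hbc hac hobs' hhalf' hqba hqbc)).trans htb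
    · have hhalf' : (1 / 2 : ℝ) ≤ w s(o, c) ∨ (1 / 2 : ℝ) ≤ w s(o, a) ∨ (1 / 2 : ℝ) ≤ w s(o, b) := by tauto
      exact (OneCutFive.measureReal_le_one_le_compl_of_exchange w R o c a b hc ha hb hac.symm hbc.symm hab
        (pocketExchange_of_half_le_hair w o c a b hco hao hbo hac.symm hbc.symm hab hobs'' hhalf' (hqcb.trans hqba)
          hqcb)).trans htc

end ThreePort

end Summit.CriticalPhenomena.PercolationContinuityZ3.Theorems

end
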